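import Literature.NumberTheory.EllipticCurves.TwoDescentLocalSelmerOfExhibit
import Literature.NumberTheory.EllipticCurves.QuadraticTwist
import HarnessLib

/-!
# Complete `2`-descent on a quadratic twist, I: the twist model and the places where `d` is a square

For an elliptic curve `E/ℚ` with rational `2`-torsion (`SplitTwoTorsion e₁ e₂ e₃`: the `2`-division cubic is
`4(x - e₁)(x - e₂)(x - e₃)`) and `d ∈ ℚˣ`, the tree's quadratic twist
`E^{(d)} = quadraticTwist E d : y² = x³ + d(b₂/4)x² + d²(b₄/2)x + d³(b₆/4)` (Silverman, *AEC*, X.§2 / X.5.4;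
`QuadraticTwist.lean`) is `y² = (x - d e₁)(x - d e₂)(x - d e₃)`: it has rational `2`-torsion `d e₁, d e₂, d e₃`
(`SplitTwoTorsion.quadraticTwist`, `equation_quadraticTwist_iff`), so the complete `2`-descent
`P ↦ (x(P) - d e₁, x(P) - d e₂) ∈ (ℚˣ/ℚˣ²)²` (Silverman Prop. X.1.4) and the tree's descent–Selmer bridge
(`TwoDescentKummerBridge*.lean`, `TwoDescentClassOfPair.lean`, `TwoDescentLocalSelmerOfExhibit.lean`) apply to
it verbatim.

At a completion `ℚ_v` in which `d = s²` is a SQUARE, `E^{(d)} ≅ E` over `ℚ_v` by `(x, y) ↦ (x/s², y/s³ - (a₁x/s² + a₃)/2)`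
and this isomorphism multiplies both descent components by the square `s²`; hence the local descent images
`δ(E^{(d)}(ℚ_v))` and `δ(E(ℚ_v))` COINCIDE as subsets of `(ℚ_vˣ/ℚ_vˣ²)²` (`exists_twoDescentComponent_pair_eq_quadraticTwist_iff`),
and a class of `H¹(ℚ, E^{(d)}[2])` satisfies the local Selmer condition of `E^{(d)}` at `v` iff the class of
`H¹(ℚ, E[2])` with the SAME components `([a], [b])` satisfies that of `E`
(`mem_selmerLocalKer_quadraticTwist_iff_of_isSquare`, `twoDescentClass_quadraticTwist_mem_selmerLocalKer_iff`).
This is the remark "the local condition at `q` for defining the `2`-Selmer group does not change by the quadratic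
twist corresponding to `ℚ(√d)`" when `(d/q) = 1` (Matsuno 2009, proof of Cor. 6.2; Kramer 1981, proof of Thm. 1),
here for ALL places where `d` is a local square, including `2` and `∞` and the bad places of `E`, and on the
tree's cohomological `Sel⁽²⁾` — with NO computation of the local images themselves.

Theorems only (and the dot-notation lemma `SplitTwoTorsion.quadraticTwist`); no named fact. Cell `bsd-f1-sign2`
(LEAD gk2-p1): first file of the explicit `2`-descent for the genus twists `E₀^{(M)}`, `E₀^{(−p₀M)}` of a
full-`2`-torsion base (LINE 49 «full_vertex», stub D0≤2, crux R″ `RankOneTwoTorsionResidualAtTwo`).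

## References

* [SilvermanAEC2009] J. H. Silverman, *The Arithmetic of Elliptic Curves*, 2nd ed., GTM 106, Springer 2009,
  Prop. X.1.4, X.§2 (Prop. 2.4 and the remark after it), X.5.4, Prop. X.4.9.
* [Kramer1981] K. Kramer, *Arithmetic of elliptic curves upon quadratic extension*, Trans. AMS 264 (1981)
  121–135, proof of Thm. 1 (local norm indices at split places).
* [Matsuno2009] K. Matsuno, *Elliptic curves with large Tate–Shafarevich groups over a number field*,
  Math. Res. Lett. 16 (2009), proof of Cor. 6.2 (p. 460).
-/

noncomputable section

open scoped Classical

universe u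

/-! ## §1 The twist model: rational `2`-torsion `d e₁, d e₂, d e₃` and the factored equation -/

namespace WeierstrassCurve.Affine.SplitTwoTorsion

variable {F : Type*} [Field F] [NeZero (2 : F)] {W : WeierstrassCurve F} {e₁ e₂ e₃ : F}

/-- **The quadratic twist of a curve with rational `2`-torsion `e₁, e₂, e₃` has rational `2`-torsion
`d e₁, d e₂, d e₃`** (`bᵢ(E^{(d)}) = dⁱ⸍² bᵢ(E)`). [cite: SilvermanAEC2009, X.§2 (remark after Prop. 2.4), Prop. X.1.4] -/
theorem quadraticTwist (h : W.toAffine.SplitTwoTorsion e₁ e₂ e₃) (d : F) :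
    (W.quadraticTwist d).toAffine.SplitTwoTorsion (d * e₁) (d * e₂) (d * e₃) := by
  refine ⟨?_, ?_, ?_⟩
  · change (W.quadraticTwist d).b₂ = _
    rw [quadraticTwist_b₂, h.b₂_eq]; ring
  · change (W.quadraticTwist d).b₄ = _
    rw [quadraticTwist_b₄, h.b₄_eq]; ring
  · change (W.quadraticTwist d).b₆ = _
    rw [quadraticTwist_b₆, h.b₆_eq]; ring

end WeierstrassCurve.Affine.SplitTwoTorsion

namespace WeierstrassCurve.Affine

variable {F : Type*} [Field F] [CharZero F] {W : WeierstrassCurve F} {e₁ e₂ e₃ : F}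

/-- **The factored equation of a curve with rational `2`-torsion**: `(x, y) ∈ E` iff
`(y + (a₁x + a₃)/2)² = (x - e₁)(x - e₂)(x - e₃)`. [cite: SilvermanAEC2009, III.§1 (completing the square), Prop. X.1.4] -/
theorem SplitTwoTorsion.equation_iff_sq_eq (h : W.toAffine.SplitTwoTorsion e₁ e₂ e₃) (x y : F) :
    W.toAffine.Equation x y ↔ (y + (W.a₁ * x + W.a₃) / 2) ^ 2 = (x - e₁) * (x - e₂) * (x - e₃) := by
  have hb2 := h.a₂_eq
  have hb4 := h.a₄_eq
  have hb6 := h.a₆_eq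
  rw [equation_iff]
  constructor
  · intro hxy
    linear_combination hxy + ((1 / 4 : F) * x ^ 2) * hb2 + ((1 / 2 : F) * x) * hb4 + ((1 / 4 : F)) * hb6
  · intro hxy
    linear_combination hxy - ((1 / 4 : F) * x ^ 2) * hb2 - ((1 / 2 : F) * x) * hb4 - ((1 / 4 : F)) * hb6

/-- **The equation of the twist is `y² = (x - d e₁)(x - d e₂)(x - d e₃)`.**
[cite: SilvermanAEC2009, X.§2 (remark after Prop. 2.4), Prop. X.1.4] -/
theorem SplitTwoTorsion.equation_quadraticTwist_iff (h : W.toAffine.SplitTwoTorsion e₁ e₂ e₃) (d x y : F) :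
    (W.quadraticTwist d).toAffine.Equation x y ↔ y ^ 2 = (x - d * e₁) * (x - d * e₂) * (x - d * e₃) := by
  rw [(h.quadraticTwist d).equation_iff_sq_eq]
  have h1 : (W.quadraticTwist d).a₁ = 0 := rfl
  have h3 : (W.quadraticTwist d).a₃ = 0 := rfl
  simp only [show (W.quadraticTwist d).toAffine.a₁ = 0 from h1, show (W.quadraticTwist d).toAffine.a₃ = 0 from h3,
    zero_mul, zero_div, add_zero]

/-- **Transfer of points when `d = s²`, twist to curve**: if `y² = ∏ (x - s² eᵢ)` then
`(x/s², y/s³ - (a₁ x/s² + a₃)/2)` lies on `E`. [cite: SilvermanAEC2009, X.§2 Prop. 2.4 (twists trivialised by a square)] -/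
theorem SplitTwoTorsion.equation_of_equation_quadraticTwist_sq (h : W.toAffine.SplitTwoTorsion e₁ e₂ e₃) {s x y : F}
    (hs : s ≠ 0) (hxy : (W.quadraticTwist (s ^ 2)).toAffine.Equation x y) :
    W.toAffine.Equation (x / s ^ 2) (y / s ^ 3 - (W.a₁ * (x / s ^ 2) + W.a₃) / 2) := by
  rw [h.equation_quadraticTwist_iff] at hxy
  rw [h.equation_iff_sq_eq, sub_add_cancel, div_pow, hxy]
  field_simp

/-- **Transfer of points when `d = s²`, curve to twist**: if `(x, y) ∈ E` then
`(s² x, s³ (y + (a₁x + a₃)/2))` lies on `E^{(s²)}`. [cite: SilvermanAEC2009, X.§2 Prop. 2.4 (twists trivialised by a square)] -/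
theorem SplitTwoTorsion.equation_quadraticTwist_sq_of_equation (h : W.toAffine.SplitTwoTorsion e₁ e₂ e₃) {s x y : F}
    (hxy : W.toAffine.Equation x y) :
    (W.quadraticTwist (s ^ 2)).toAffine.Equation (s ^ 2 * x) (s ^ 3 * (y + (W.a₁ * x + W.a₃) / 2)) := by
  rw [h.equation_iff_sq_eq] at hxy
  rw [h.equation_quadraticTwist_iff]
  linear_combination s ^ 6 * hxy

omit [CharZero F] in
/-- **The transfer multiplies descent components by squares.** For two curves `V, V'` over `F` with points
`(x, y) ∈ V`, `(x', y') ∈ V'` related by `x = s² x'` (`s ≠ 0`), the descent component of `(x, y)` for the roots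
`s²e₁, s²e₂, s²e₃` equals that of `(x', y')` for `e₁, e₂, e₃` (`e₁ ≠ e₂`, `e₁ ≠ e₃`).
[cite: SilvermanAEC2009, Prop. X.1.4] -/
theorem Point.twoDescentComponent_some_eq_of_eq_sq_mul {V V' : Affine F} {s x y x' y' : F} (hs : s ≠ 0)
    (hx : x = s ^ 2 * x') (hP : V.Nonsingular x y) (hP' : V'.Nonsingular x' y') (h₁₂ : e₁ ≠ e₂) (h₁₃ : e₁ ≠ e₃) :
    Point.twoDescentComponent V (s ^ 2 * e₁) (s ^ 2 * e₂) (s ^ 2 * e₃) (.some x y hP) =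
      Point.twoDescentComponent V' e₁ e₂ e₃ (.some x' y' hP') := by
  have hs2 : s ^ 2 ≠ 0 := pow_ne_zero 2 hs
  by_cases hx' : x' = e₁
  · have hxe : x = s ^ 2 * e₁ := by rw [hx, hx']
    rw [twoDescentComponent_some_of_eq hP hxe, twoDescentComponent_some_of_eq hP' hx']
    have hc : (e₁ - e₂) * (e₁ - e₃) ≠ 0 := mul_ne_zero (sub_ne_zero.mpr h₁₂) (sub_ne_zero.mpr h₁₃)
    refine sqClass_eq_sqClass_of_isSquare_mul ?_ hc ⟨s ^ 2 * ((e₁ - e₂) * (e₁ - e₃)), by ring⟩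
    have : (s ^ 2 * e₁ - s ^ 2 * e₂) * (s ^ 2 * e₁ - s ^ 2 * e₃) = (s ^ 2) ^ 2 * ((e₁ - e₂) * (e₁ - e₃)) := by ring
    rw [this]; exact mul_ne_zero (pow_ne_zero 2 hs2) hc
  · have hxe : x ≠ s ^ 2 * e₁ := by
      rw [hx]; intro h'; exact hx' (mul_left_cancel₀ hs2 h')
    rw [twoDescentComponent_some_of_ne hP hxe, twoDescentComponent_some_of_ne hP' hx']
    have hc : x' - e₁ ≠ 0 := sub_ne_zero.mpr hx'
    refine sqClass_eq_sqClass_of_isSquare_mul (sub_ne_zero.mpr hxe) hc ⟨s * (x' - e₁), ?_⟩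
    rw [hx]; ring

end WeierstrassCurve.Affine

/-! ## §2 Over a completion where `d` is a square: the two local descent images coincide -/

namespace WeierstrassCurve

open Literature.NumberTheory.GaloisRepresentations Literature.NumberTheory.EllipticCurves Field
open WeierstrassCurve.Affine WeierstrassCurve.Affine.Point
open Literature.NumberTheory.EllipticCurves.TwoDescentLocal

variable {K : Type u} [Field K] [CharZero K] (W : WeierstrassCurve K) {e₁ e₂ e₃ : K}
variable (E : Type u) [Field E] [Algebra K E]

omit [CharZero K] in
/-- The base change of the twist is the twist of the base change (restated from
`IrreducibleModPQuadraticTwistProofs.baseChange_quadraticTwist` to keep the imports of the `2`-descent light).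
[cite: SilvermanAEC2009, X.§2] -/
private theorem baseChange_quadraticTwist' (d : K) :
    (W.quadraticTwist d).baseChange E = (W.baseChange E).quadraticTwist (algebraMap K E d) := by
  rw [baseChange, baseChange]
  ext
  · simp
  · simp [map_div₀, map_ofNat]
  · simp
  · simp [map_div₀, map_ofNat]
  · simp [map_div₀, map_ofNat]

/-- **At a completion where `d = s²`: every descent pair of `E^{(d)}(E)` is a descent pair of `E(E)` and
conversely** (the isomorphism `(x, y) ↦ (x/s², …)` scales both components by `s²`). Components are taken for
the roots `d e₁, d e₂, d e₃` of the twist and `e₁, e₂, e₃` of the curve. [cite: SilvermanAEC2009, Prop. X.1.4, X.§2 Prop. 2.4] -/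
theorem exists_twoDescentComponent_pair_eq_quadraticTwist_iff (hE : CharZero E) [W.IsElliptic]
    (h : W.toAffine.SplitTwoTorsion e₁ e₂ e₃) {d : K} [(W.quadraticTwist d).IsElliptic] {s : E}
    (hs : algebraMap K E d = s ^ 2) (α β : SqUnits E) :
    (∃ P : ((W.quadraticTwist d).baseChange E).toAffine.Point,
      twoDescentComponent ((W.quadraticTwist d).baseChange E).toAffine (algebraMap K E (d * e₁))
          (algebraMap K E (d * e₂)) (algebraMap K E (d * e₃)) P = α ∧
      twoDescentComponent ((W.quadraticTwist d).baseChange E).toAffine (algebraMap K E (d * e₂))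
          (algebraMap K E (d * e₁)) (algebraMap K E (d * e₃)) P = β) ↔
    (∃ P : (W.baseChange E).toAffine.Point,
      twoDescentComponent (W.baseChange E).toAffine (algebraMap K E e₁) (algebraMap K E e₂) (algebraMap K E e₃) P = α ∧
      twoDescentComponent (W.baseChange E).toAffine (algebraMap K E e₂) (algebraMap K E e₁) (algebraMap K E e₃) P = β) := by
  haveI := hE
  haveI := W.isElliptic_baseChange E
  haveI := (W.quadraticTwist d).isElliptic_baseChange E
  have hE' := h.map E
  have hs0 : s ≠ 0 := by
    intro h0
    have hd : d ≠ 0 := by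
      intro hd0
      have hΔ : (W.quadraticTwist d).Δ ≠ 0 := by
        rw [← coe_Δ']; exact (W.quadraticTwist d).Δ'.ne_zero
      rw [quadraticTwist_Δ, hd0, zero_pow (by norm_num), zero_mul] at hΔ
      exact hΔ rfl
    apply hd
    apply (algebraMap K E).injective
    rw [hs, h0, RingHom.map_zero, zero_pow two_ne_zero]
  -- the twist over `E` is the twist of `E/E` by the square `s²`
  have hcurve : (W.quadraticTwist d).baseChange E = (W.baseChange E).quadraticTwist (s ^ 2) := by
    rw [baseChange_quadraticTwist', hs]
  have hVsq : ∀ x y : E, ((W.quadraticTwist d).baseChange E).toAffine.Equation x y ↔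
      ((W.baseChange E).quadraticTwist (s ^ 2)).toAffine.Equation x y := fun x y => by rw [hcurve]
  have hroots : ∀ e : K, algebraMap K E (d * e) = s ^ 2 * algebraMap K E e := fun e => by
    rw [map_mul, hs]
  rw [hroots e₁, hroots e₂, hroots e₃]
  constructor
  · rintro ⟨P, hPa, hPb⟩
    rcases P with _ | ⟨x, y, hP⟩
    · exact ⟨0, by rw [← hPa]; rfl, by rw [← hPb]; rfl⟩
    · -- the point `(x/s², y/s³ - (a₁x/s² + a₃)/2)` of `E(E)`
      have hxy : ((W.baseChange E).quadraticTwist (s ^ 2)).toAffine.Equation x y := (hVsq x y).mp hP.1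
      have hQ := hE'.equation_of_equation_quadraticTwist_sq hs0 hxy
      have hQns := (equation_iff_nonsingular).mp hQ
      have hx : x = s ^ 2 * (x / s ^ 2) := by field_simp
      refine ⟨.some _ _ hQns, ?_, ?_⟩
      · rw [← hPa]
        exact (twoDescentComponent_some_eq_of_eq_sq_mul hs0 hx hP hQns hE'.ne₁₂ hE'.ne₁₃).symm
      · rw [← hPb]
        exact (twoDescentComponent_some_eq_of_eq_sq_mul hs0 hx hP hQns hE'.ne₁₂.symm hE'.ne₂₃).symm
  · rintro ⟨P, hPa, hPb⟩
    rcases P with _ | ⟨x, y, hP⟩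
    · exact ⟨0, by rw [← hPa]; rfl, by rw [← hPb]; rfl⟩
    · -- the point `(s²x, s³(y + (a₁x + a₃)/2))` of `E^{(d)}(E)`
      have hQ : ((W.quadraticTwist d).baseChange E).toAffine.Equation (s ^ 2 * x)
          (s ^ 3 * (y + ((W.baseChange E).a₁ * x + (W.baseChange E).a₃) / 2)) :=
        (hVsq _ _).mpr (hE'.equation_quadraticTwist_sq_of_equation hP.1)
      have hQns := (equation_iff_nonsingular).mp hQ
      refine ⟨.some _ _ hQns, ?_, ?_⟩
      · rw [← hPa]
        exact twoDescentComponent_some_eq_of_eq_sq_mul hs0 rfl hQns hP hE'.ne₁₂ hE'.ne₁₃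
      · rw [← hPb]
        exact twoDescentComponent_some_eq_of_eq_sq_mul hs0 rfl hQns hP hE'.ne₁₂.symm hE'.ne₂₃

/-- **The local Selmer condition does not see a twist by a local square.** Let `c ∈ H¹(K, E[2])` and
`c' ∈ H¹(K, E^{(d)}[2])` have the SAME components `([a], [b]) ∈ (Kˣ/Kˣ²)²` (for the roots `eᵢ`, resp. `d eᵢ`),
and let `E` be a `K`-field in which `d` is a square. Then `c'` satisfies the local Selmer condition of `E^{(d)}`
at `E` iff `c` satisfies that of `E`. [cite: SilvermanAEC2009, Prop. X.1.4, Prop. X.4.9]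
[cite: Matsuno2009, proof of Cor. 6.2 (p. 460)] -/
theorem mem_selmerLocalKer_quadraticTwist_iff_of_isSquare (hE : CharZero E) [W.IsElliptic]
    (h : W.toAffine.SplitTwoTorsion e₁ e₂ e₃) {d : K} [(W.quadraticTwist d).IsElliptic]
    (hd : IsSquare (algebraMap K E d)) (a b : Kˣ) {c : galH1Torsion W 2} {c' : galH1Torsion (W.quadraticTwist d) 2}
    (ha : kummerEquiv K 2 (W.twoTorsionCharH1 h c) = Additive.ofMul (QuotientGroup.mk a))
    (hb : kummerEquiv K 2 (W.twoTorsionCharH1 h.swap₁₂ c) = Additive.ofMul (QuotientGroup.mk b))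
    (ha' : kummerEquiv K 2 ((W.quadraticTwist d).twoTorsionCharH1 (h.quadraticTwist d) c') =
      Additive.ofMul (QuotientGroup.mk a))
    (hb' : kummerEquiv K 2 ((W.quadraticTwist d).twoTorsionCharH1 (h.quadraticTwist d).swap₁₂ c') =
      Additive.ofMul (QuotientGroup.mk b)) :
    c' ∈ selmerLocalKer (W.quadraticTwist d) E 2 ↔ c ∈ selmerLocalKer W E 2 := by
  haveI := hE
  haveI := W.isElliptic_baseChange E
  haveI := (W.quadraticTwist d).isElliptic_baseChange E
  obtain ⟨s, hs⟩ := hd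
  rw [← pow_two] at hs
  have e₁ : c ∈ selmerLocalKer W E 2 ↔
      galoisCohomology.res (W.torsionGaloisModule 2) E 1 c ∈ W.kummerLocalConditionAt 2 E :=
    (SetLike.ext_iff.mp (W.comap_res_kummerLocalConditionAt 2 E) c).symm
  have e₂ : c' ∈ selmerLocalKer (W.quadraticTwist d) E 2 ↔
      galoisCohomology.res ((W.quadraticTwist d).torsionGaloisModule 2) E 1 c' ∈
        (W.quadraticTwist d).kummerLocalConditionAt 2 E :=
    (SetLike.ext_iff.mp ((W.quadraticTwist d).comap_res_kummerLocalConditionAt 2 E) c').symm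
  refine (e₂.trans ?_).trans e₁.symm
  rw [(W.quadraticTwist d).res_mem_kummerLocalConditionAt_iff_exists_twoDescentComponent_pair_eq E
      (h.quadraticTwist d) a b ha' hb',
    W.res_mem_kummerLocalConditionAt_iff_exists_twoDescentComponent_pair_eq E h a b ha hb]
  exact W.exists_twoDescentComponent_pair_eq_quadraticTwist_iff E hE h hs _ _

/-- **The same for the classes `c(a, b)` with prescribed components** (`twoDescentClass`): at a `K`-field `E`
in which `d` is a square, `c_{E^{(d)}}(a, b)` is locally Selmer iff `c_E(a, b)` is.
[cite: SilvermanAEC2009, Prop. X.1.4, Prop. X.4.9] [cite: Matsuno2009, proof of Cor. 6.2 (p. 460)] -/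
theorem twoDescentClass_quadraticTwist_mem_selmerLocalKer_iff (hE : CharZero E) [W.IsElliptic]
    (h : W.toAffine.SplitTwoTorsion e₁ e₂ e₃) {d : K} [(W.quadraticTwist d).IsElliptic]
    (hd : IsSquare (algebraMap K E d)) (a b : Kˣ) :
    (W.quadraticTwist d).twoDescentClass (h.quadraticTwist d) a b ∈ selmerLocalKer (W.quadraticTwist d) E 2 ↔
      W.twoDescentClass h a b ∈ selmerLocalKer W E 2 :=
  W.mem_selmerLocalKer_quadraticTwist_iff_of_isSquare E hE h hd a b
    (W.kummerEquiv_twoTorsionCharH1_twoDescentClass h a b) (W.kummerEquiv_twoTorsionCharH1_swap_twoDescentClass h a b)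
    ((W.quadraticTwist d).kummerEquiv_twoTorsionCharH1_twoDescentClass _ a b)
    ((W.quadraticTwist d).kummerEquiv_twoTorsionCharH1_swap_twoDescentClass _ a b)

end WeierstrassCurve

end
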